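import Summits.QuantumFields.BalabanUV.Beta.D1BFx.SbpShellTerm

/-!
# `BalabanUV.Beta.D1BFx.SbpShellRemainder` — road «BF-x» for binder row D1: THE SUMMATION-BY-PARTS SCALAR WALL, PART 3 OF 4 —
# the first-order remainder `B = w_μw_ν·(D_{μν}g·Q_G + P_G)` (exterior tail, window comparison against `stK g`) and the n-UNIFORM A₁-FORM `sbp_A1`

HONEST DEPENDENCY (page 1, mandatory): continuum YM on T⁴ ⇐ BetaPertH ∧ nine spine estimates (0/9 proved); BetaPertH ⇐ (D1) ∧ (D4) ∧ CAP+tail;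
G-an2-4 gates asym, D1 and NE2/3/4.  HONEST FRAMING (cell contract, verbatim): «discharging `BetaPertH` makes Bałaban's UV stability UNCONDITIONAL —
a real constructive-QFT result; it is NOT the continuum limit and NOT the Clay problem.»  THIS MODULE DISCHARGES NOTHING of the wall by itself:
[folklore] analysis about ARBITRARY functions `G, g : ℤ⁴ → ℝ` under displayed rows; no `def`, no `Prop` mirror, no cited fact, 0 sorry.
0 wall binders instantiated; NOT D1, NOT `BetaPertH`, NOT continuum, NOT Clay.

ABSOLUTE RULE (cell charter, verbatim): «No internally-minted statement may enter as a cited fact. Every hypothesis is either kernel-proved in this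
package or a verbatim quotation of a PUBLISHED theorem with page reference. The manuscript(s) under audit are NOT citable for their own disputed steps —
they are the thing under adjudication; programme-internal (2001/route/tribunal) claims are never citable.»

CONTENT ([folklore]; same displayed rows and explicit lambda expressions `φ`, `ψ`, `B` as PART 2, plus `|D_{μν}g| ≤ C₄∕‖·‖⁴` off the origin).  `stK_eq_sbp_add_rem` (`stK G = φ·(ψ(·+e_ν) − ψ) + B`),
`rem_sub_free_eq`, `abs_rem_le_tail` (`|B(w)| ≤ E_B·e^{−(δ∕n)(r+1)}∕(r+1)⁴`, `E_B = e^{δ}N²(80A₀C₄ + 1280A₁²)`, shells `r ≥ 1`), `window_rem_sub_free_le`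
(`Σ_shell |B − stK g| ≤ K_W∕n`, `K_W = 1600N²(C₄D₀ + D₁(16U₀+9C₃) + D₁²)`), and **`sbp_A1`**:
`|fullSum (stK μ ν N G) − Σ_{0<‖w‖∞≤n} stK μ ν N g w| ≤ K_S + K_W + 80(E_S + E_B)(1 + 1∕δ)` — NO second-difference row of `G`, n-uniform.
The END is PART 4 `SbpScalarEnd.d1Drift_of_strongRoad_sbp`.
Unit `b2b-balaban-beta-d1-p2` (gen 13), road «BF-x» OWNER; `LEAVES-BFx.md` row «C3-SBP»; CENSUS-K6a §v4.22.
-/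

noncomputable section

open Finset Filter Topology
open scoped BigOperators
open Literature.Probability.LatticeModels (annulus box)
open Literature.MathematicalPhysics.QuantumFieldTheory.Balaban1983to89
open Literature.MathematicalPhysics.QuantumFieldTheory.Balaban1983to89.Beta
open B12Sec2to5 (l1 l1_nonneg)
open DyadicShell (Pt toReal supNorm mem_annulus_iff ne_zero_of_mem_annulus supNorm_eq_of_mem_sphere supNorm_eq_zero_iff natAbs_le_supNorm
  toReal_apply)
open BubbleTransfer (Leg unitVec)
open TwoPowerLegs (free freeMixedLeg supNorm_sub_le_supNorm_add supNorm_unitVec abs_latticeGreen_half_le freeMixedLeg_a free_g)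
open GhostTable (gFree mixedDiffFun fwdDiffFun cellForm freeMixedLeg_f)
open SquareTable (stK stK_eq_closedForm mixedDiffFun_sq)
open WindowIdentification (fullSum psum)
open ExpKernelCalculus (summable_exp_shift')
open Summit.QuantumFields.BalabanUV.Beta.D1BFx.SbpShellAlgebra
open Summit.QuantumFields.BalabanUV.Beta.D1BFx.SbpShellTerm

namespace Summit.QuantumFields.BalabanUV.Beta.D1BFx.SbpShellRemainder

variable {μ ν : Fin 4}

section Main

variable (hμν : μ ≠ ν) (N : ℝ) {n : ℕ} (hn : 2 ≤ n) (G g : Pt → ℝ) {U0 C2 C3 C4 D0 D1 A0 A1 δ : ℝ}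
  (hU0 : 0 ≤ U0) (hC2 : 0 ≤ C2) (hC3 : 0 ≤ C3) (hC4 : 0 ≤ C4) (hD0 : 0 ≤ D0) (hD1 : 0 ≤ D1) (hA0 : 0 ≤ A0) (hA1 : 0 ≤ A1) (hδ : 0 < δ)
  (hgU : ∀ v, |g v| ≤ U0) (hg2 : ∀ v : Pt, v ≠ 0 → |g v| ≤ C2 / (supNorm v : ℝ) ^ 2)
  (hg3 : ∀ v : Pt, v ≠ 0 → ∀ ρ : Fin 4, |g (v + unitVec ρ) - g v| ≤ C3 / (supNorm v : ℝ) ^ 3)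
  (hg4 : ∀ v : Pt, v ≠ 0 → |mixedDiffFun g (unitVec μ) (unitVec ν) v| ≤ C4 / (supNorm v : ℝ) ^ 4)
  (h0 : ∀ v, |G v - g v| ≤ D0 / (n : ℝ) ^ 2)
  (h1 : ∀ v (ρ : Fin 4), |(G (v + unitVec ρ) - g (v + unitVec ρ)) - (G v - g v)| ≤ D1 / (n : ℝ) ^ 3)
  (d0 : ∀ v : Pt, v ≠ 0 → |G v| ≤ A0 * Real.exp (-(δ / n) * supNorm v) / (supNorm v : ℝ) ^ 2)
  (d1 : ∀ v : Pt, v ≠ 0 → ∀ ρ : Fin 4, |G (v + unitVec ρ) - G v| ≤ A1 * Real.exp (-(δ / n) * supNorm v) / (supNorm v : ℝ) ^ 3)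


/-- [folklore] **THE SPLIT OF THE (1.22) INTEGRAND**: `stK G = φ·(ψ(·+e_ν) − ψ) + B` — the only second difference of the correction sits in the first term. -/
theorem stK_eq_sbp_add_rem (w : Pt) : stK μ ν N G w = (fun v : Pt => toReal v μ * toReal v ν * (8 * N ^ 2 * (G (v + unitVec ν + unitVec μ) + G (v + unitVec ν)) - 4 * N ^ 2 * G v)) w * ((fun v : Pt => (G (v + unitVec μ) - g (v + unitVec μ)) - (G v - g v)) (w + unitVec ν) - (fun v : Pt => (G (v + unitVec μ) - g (v + unitVec μ)) - (G v - g v)) w) + (fun w : Pt => toReal w μ * toReal w ν * (mixedDiffFun g (unitVec μ) (unitVec ν) w * (8 * N ^ 2 * (G (w + unitVec ν + unitVec μ) + G (w + unitVec ν)) - 4 * N ^ 2 * G w) + (8 * N ^ 2 * (fwdDiffFun G (unitVec μ) w * (fwdDiffFun G (unitVec ν) (w + unitVec μ) + fwdDiffFun G (unitVec ν) w)) + 4 * N ^ 2 * (fwdDiffFun G (unitVec μ) w * fwdDiffFun G (unitVec ν) w)))) w := by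
  rw [stK_decomp N G w, mixedDiffFun_split G g (unitVec μ) (unitVec ν) w, mixedDiffFun_eq_fwd_sub (fun v => G v - g v)]
  simp only [fwdDiffFun]
  ring

/-- [folklore] **THE REMAINDER AGAINST THE REFERENCE INTEGRAND, POINTWISE**: `B(w) − stK g(w) = w_μw_ν·[D_{μν}g·(Q_G − Q_g) + (P_G − P_g)]`. -/
theorem rem_sub_free_eq (w : Pt) : (fun w : Pt => toReal w μ * toReal w ν * (mixedDiffFun g (unitVec μ) (unitVec ν) w * (8 * N ^ 2 * (G (w + unitVec ν + unitVec μ) + G (w + unitVec ν)) - 4 * N ^ 2 * G w) + (8 * N ^ 2 * (fwdDiffFun G (unitVec μ) w * (fwdDiffFun G (unitVec ν) (w + unitVec μ) + fwdDiffFun G (unitVec ν) w)) + 4 * N ^ 2 * (fwdDiffFun G (unitVec μ) w * fwdDiffFun G (unitVec ν) w)))) w - stK μ ν N g w = toReal w μ * toReal w ν *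
    (mixedDiffFun g (unitVec μ) (unitVec ν) w *
        ((8 * N ^ 2 * (G (w + unitVec ν + unitVec μ) + G (w + unitVec ν)) - 4 * N ^ 2 * G w) -
          (8 * N ^ 2 * (g (w + unitVec ν + unitVec μ) + g (w + unitVec ν)) - 4 * N ^ 2 * g w)) +
      ((8 * N ^ 2 * (fwdDiffFun G (unitVec μ) w * (fwdDiffFun G (unitVec ν) (w + unitVec μ) + fwdDiffFun G (unitVec ν) w)) +
          4 * N ^ 2 * (fwdDiffFun G (unitVec μ) w * fwdDiffFun G (unitVec ν) w)) -
        (8 * N ^ 2 * (fwdDiffFun g (unitVec μ) w * (fwdDiffFun g (unitVec ν) (w + unitVec μ) + fwdDiffFun g (unitVec ν) w)) +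
          4 * N ^ 2 * (fwdDiffFun g (unitVec μ) w * fwdDiffFun g (unitVec ν) w)))) := by
  rw [stK_decomp N g w]
  ring

include hμν hn hC4 hA0 hA1 hδ hg4 d0 d1 in
/-- [folklore] **THE REMAINDER ON AN EXTERIOR SHELL** (`r ≥ 1`): `|B(w)| ≤ E_B·e^{−(δ/n)(r+1)}/(r+1)⁴`, `E_B = e^{δ}N²(80A₀C₄ + 1280A₁²)`
(the free mixed leg `C₄/‖w‖⁴`, `d0` for `Q_G`, `d1` for the three first differences — one exponential kept). -/
theorem abs_rem_le_tail {r : ℕ} (hr : 1 ≤ r) {w : Pt} (hw : w ∈ annulus 4 r (r + 1)) :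
    |(fun w : Pt => toReal w μ * toReal w ν * (mixedDiffFun g (unitVec μ) (unitVec ν) w * (8 * N ^ 2 * (G (w + unitVec ν + unitVec μ) + G (w + unitVec ν)) - 4 * N ^ 2 * G w) + (8 * N ^ 2 * (fwdDiffFun G (unitVec μ) w * (fwdDiffFun G (unitVec ν) (w + unitVec μ) + fwdDiffFun G (unitVec ν) w)) + 4 * N ^ 2 * (fwdDiffFun G (unitVec μ) w * fwdDiffFun G (unitVec ν) w)))) w| ≤ Real.exp δ * N ^ 2 * (80 * A0 * C4 + 1280 * A1 ^ 2) / ((r : ℝ) + 1) ^ 4 * Real.exp (-(δ / n) * ((r : ℝ) + 1)) := by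
  obtain ⟨hn0, hn1, hc, hexp⟩ := n_facts hn hδ
  have ht0 : (0 : ℝ) < (r : ℝ) + 1 := by positivity
  obtain ⟨hs0, hsμ, hsν, hsνμ, hsn⟩ := supNorm_shifts_le_one hμν
  have hw0 : w ≠ 0 := ne_zero_of_mem_annulus hw
  set t := (r : ℝ) + 1 with ht
  have hsup : (supNorm w : ℝ) = t := by rw [ht, supNorm_eq_of_mem_sphere hw]; push_cast; ring
  set Ex := Real.exp (-(δ / n) * t) with hEx
  have hwt : |toReal w μ * toReal w ν| ≤ t ^ 2 := by
    rw [abs_mul, sq]; exact mul_le_mul (hsup ▸ abs_toReal_le w μ) (hsup ▸ abs_toReal_le w ν) (abs_nonneg _) (by positivity)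
  have hD : |mixedDiffFun g (unitVec μ) (unitVec ν) w| ≤ C4 / t ^ 4 := by have h := hg4 w hw0; rwa [hsup] at h
  have hQ := abs_Q_le_tail hμν N hn G hA0 hδ d0 hr hw
  have hX : |fwdDiffFun G (unitVec μ) w| ≤ 8 * A1 * Real.exp (δ / n) * Ex / t ^ 3 := by
    have h := abs_dG_shift_le_tail hA1 hc d1 hr hw hs0 μ
    simp only [add_zero] at h
    exact h
  have hY : |fwdDiffFun G (unitVec ν) (w + unitVec μ)| ≤ 8 * A1 / t ^ 3 := abs_dG_shift_le_tail' hA1 hc d1 hr hw hsμ ν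
  have hZ : |fwdDiffFun G (unitVec ν) w| ≤ 8 * A1 / t ^ 3 := by
    have h := abs_dG_shift_le_tail' hA1 hc d1 hr hw hs0 ν
    simp only [add_zero] at h
    exact h
  have hN : (0 : ℝ) ≤ N ^ 2 := sq_nonneg N
  have hP : |8 * N ^ 2 * (fwdDiffFun G (unitVec μ) w * (fwdDiffFun G (unitVec ν) (w + unitVec μ) + fwdDiffFun G (unitVec ν) w)) +
      4 * N ^ 2 * (fwdDiffFun G (unitVec μ) w * fwdDiffFun G (unitVec ν) w)| ≤
      8 * N ^ 2 * ((8 * A1 * Real.exp (δ / n) * Ex / t ^ 3) * (8 * A1 / t ^ 3 + 8 * A1 / t ^ 3)) +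
        4 * N ^ 2 * ((8 * A1 * Real.exp (δ / n) * Ex / t ^ 3) * (8 * A1 / t ^ 3)) := by
    have e1 : |fwdDiffFun G (unitVec μ) w * (fwdDiffFun G (unitVec ν) (w + unitVec μ) + fwdDiffFun G (unitVec ν) w)| ≤
        (8 * A1 * Real.exp (δ / n) * Ex / t ^ 3) * (8 * A1 / t ^ 3 + 8 * A1 / t ^ 3) := by
      rw [abs_mul]
      exact mul_le_mul hX ((abs_add_le _ _).trans (add_le_add hY hZ)) (abs_nonneg _) (by positivity)
    have e2 : |fwdDiffFun G (unitVec μ) w * fwdDiffFun G (unitVec ν) w| ≤ (8 * A1 * Real.exp (δ / n) * Ex / t ^ 3) * (8 * A1 / t ^ 3) := by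
      rw [abs_mul]
      exact mul_le_mul hX hZ (abs_nonneg _) (by positivity)
    calc _ ≤ |8 * N ^ 2 * (fwdDiffFun G (unitVec μ) w * (fwdDiffFun G (unitVec ν) (w + unitVec μ) + fwdDiffFun G (unitVec ν) w))| +
        |4 * N ^ 2 * (fwdDiffFun G (unitVec μ) w * fwdDiffFun G (unitVec ν) w)| := abs_add_le _ _
      _ ≤ _ := by
        rw [abs_mul (8 * N ^ 2), abs_mul (4 * N ^ 2), abs_of_nonneg (by positivity : (0 : ℝ) ≤ 8 * N ^ 2), abs_of_nonneg (by positivity : (0 : ℝ) ≤ 4 * N ^ 2)]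
        exact add_le_add (mul_le_mul_of_nonneg_left e1 (by positivity)) (mul_le_mul_of_nonneg_left e2 (by positivity))
  show |toReal w μ * toReal w ν * (mixedDiffFun g (unitVec μ) (unitVec ν) w *
      (8 * N ^ 2 * (G (w + unitVec ν + unitVec μ) + G (w + unitVec ν)) - 4 * N ^ 2 * G w) +
      (8 * N ^ 2 * (fwdDiffFun G (unitVec μ) w * (fwdDiffFun G (unitVec ν) (w + unitVec μ) + fwdDiffFun G (unitVec ν) w)) +
        4 * N ^ 2 * (fwdDiffFun G (unitVec μ) w * fwdDiffFun G (unitVec ν) w)))| ≤ _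
  rw [abs_mul]
  calc |toReal w μ * toReal w ν| * |mixedDiffFun g (unitVec μ) (unitVec ν) w *
        (8 * N ^ 2 * (G (w + unitVec ν + unitVec μ) + G (w + unitVec ν)) - 4 * N ^ 2 * G w) +
        (8 * N ^ 2 * (fwdDiffFun G (unitVec μ) w * (fwdDiffFun G (unitVec ν) (w + unitVec μ) + fwdDiffFun G (unitVec ν) w)) +
          4 * N ^ 2 * (fwdDiffFun G (unitVec μ) w * fwdDiffFun G (unitVec ν) w))|
      ≤ t ^ 2 * (C4 / t ^ 4 * (80 * N ^ 2 * A0 * Real.exp (δ / n) * Ex / t ^ 2) +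
          (8 * N ^ 2 * ((8 * A1 * Real.exp (δ / n) * Ex / t ^ 3) * (8 * A1 / t ^ 3 + 8 * A1 / t ^ 3)) +
            4 * N ^ 2 * ((8 * A1 * Real.exp (δ / n) * Ex / t ^ 3) * (8 * A1 / t ^ 3)))) := by
        refine mul_le_mul hwt ((abs_add_le _ _).trans (add_le_add ?_ hP)) (abs_nonneg _) (by positivity)
        rw [abs_mul]
        exact mul_le_mul hD hQ (abs_nonneg _) (by positivity)
    _ = Real.exp (δ / n) * N ^ 2 * (80 * A0 * C4 + 1280 * A1 ^ 2) / t ^ 4 * Ex := by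
        field_simp; ring
    _ ≤ Real.exp δ * N ^ 2 * (80 * A0 * C4 + 1280 * A1 ^ 2) / t ^ 4 * Ex := by gcongr

include hμν hn hU0 hC3 hC4 hD0 hD1 hgU hg3 hg4 h0 h1 in
/-- [folklore] **THE REMAINDER AGAINST THE REFERENCE ON A WINDOW SHELL** (`r + 1 ≤ n`): `Σ_{‖w‖∞=r+1}|B(w) − stK g(w)| ≤ K_W/n`,
`K_W = 1600N²(C₄D₀ + D₁(16U₀ + 9C₃) + D₁²)` (rows `h0`/`h1`, the free mixed leg and the free first differences). -/
theorem window_rem_sub_free_le {r : ℕ} (hr : r + 1 ≤ n) :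
    ∑ w ∈ annulus 4 r (r + 1), |(fun w : Pt => toReal w μ * toReal w ν * (mixedDiffFun g (unitVec μ) (unitVec ν) w * (8 * N ^ 2 * (G (w + unitVec ν + unitVec μ) + G (w + unitVec ν)) - 4 * N ^ 2 * G w) + (8 * N ^ 2 * (fwdDiffFun G (unitVec μ) w * (fwdDiffFun G (unitVec ν) (w + unitVec μ) + fwdDiffFun G (unitVec ν) w)) + 4 * N ^ 2 * (fwdDiffFun G (unitVec μ) w * fwdDiffFun G (unitVec ν) w)))) w - stK μ ν N g w| ≤ 1600 * N ^ 2 * (C4 * D0 + D1 * (16 * U0 + 9 * C3) + D1 * D1) / n := by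
  have hn1 : (1 : ℝ) ≤ n := by exact_mod_cast (le_trans one_le_two hn)
  have hn0 : (0 : ℝ) < n := by linarith
  have ht0 : (0 : ℝ) < (r : ℝ) + 1 := by positivity
  have htn : (r : ℝ) + 1 ≤ n := by exact_mod_cast hr
  obtain ⟨hs0, hsμ, hsν, hsνμ, hsn⟩ := supNorm_shifts_le_one hμν
  have hN : (0 : ℝ) ≤ N ^ 2 := sq_nonneg N
  set t := (r : ℝ) + 1 with ht
  set e0 := D0 / (n : ℝ) ^ 2 with he0
  set e1 := D1 / (n : ℝ) ^ 3 with he1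
  have he00 : 0 ≤ e0 := by rw [he0]; positivity
  have he10 : 0 ≤ e1 := by rw [he1]; positivity
  set W1 := 8 * (2 * U0 + C3) / t ^ 3 + e1 with hW1
  have hW10 : 0 ≤ W1 := by rw [hW1]; positivity
  have hpt : ∀ w ∈ annulus 4 r (r + 1), |(fun w : Pt => toReal w μ * toReal w ν * (mixedDiffFun g (unitVec μ) (unitVec ν) w * (8 * N ^ 2 * (G (w + unitVec ν + unitVec μ) + G (w + unitVec ν)) - 4 * N ^ 2 * G w) + (8 * N ^ 2 * (fwdDiffFun G (unitVec μ) w * (fwdDiffFun G (unitVec ν) (w + unitVec μ) + fwdDiffFun G (unitVec ν) w)) + 4 * N ^ 2 * (fwdDiffFun G (unitVec μ) w * fwdDiffFun G (unitVec ν) w)))) w - stK μ ν N g w| ≤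
      t ^ 2 * (C4 / t ^ 4 * (20 * N ^ 2 * e0) + 20 * N ^ 2 * (e1 * (W1 + C3 / t ^ 3))) := by
    intro w hw
    have hw0 : w ≠ 0 := ne_zero_of_mem_annulus hw
    have hsup : (supNorm w : ℝ) = t := by rw [ht, supNorm_eq_of_mem_sphere hw]; push_cast; ring
    have hwt : |toReal w μ * toReal w ν| ≤ t ^ 2 := by
      rw [abs_mul, sq]; exact mul_le_mul (hsup ▸ abs_toReal_le w μ) (hsup ▸ abs_toReal_le w ν) (abs_nonneg _) (by positivity)
    have hD : |mixedDiffFun g (unitVec μ) (unitVec ν) w| ≤ C4 / t ^ 4 := by have h := hg4 w hw0; rwa [hsup] at h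
    -- `Q_G − Q_g`
    have hQ : |(8 * N ^ 2 * (G (w + unitVec ν + unitVec μ) + G (w + unitVec ν)) - 4 * N ^ 2 * G w) -
        (8 * N ^ 2 * (g (w + unitVec ν + unitVec μ) + g (w + unitVec ν)) - 4 * N ^ 2 * g w)| ≤ 20 * N ^ 2 * e0 := by
      have a1 := h0 (w + unitVec ν + unitVec μ)
      have a2 := h0 (w + unitVec ν)
      have a3 := h0 w
      have e : (8 * N ^ 2 * (G (w + unitVec ν + unitVec μ) + G (w + unitVec ν)) - 4 * N ^ 2 * G w) -
          (8 * N ^ 2 * (g (w + unitVec ν + unitVec μ) + g (w + unitVec ν)) - 4 * N ^ 2 * g w) =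
          8 * N ^ 2 * ((G (w + unitVec ν + unitVec μ) - g (w + unitVec ν + unitVec μ)) + (G (w + unitVec ν) - g (w + unitVec ν))) -
            4 * N ^ 2 * (G w - g w) := by ring
      rw [e]
      calc _ ≤ |8 * N ^ 2 * ((G (w + unitVec ν + unitVec μ) - g (w + unitVec ν + unitVec μ)) + (G (w + unitVec ν) - g (w + unitVec ν)))| +
          |4 * N ^ 2 * (G w - g w)| := abs_sub _ _
        _ ≤ 8 * N ^ 2 * (e0 + e0) + 4 * N ^ 2 * e0 := by
          rw [abs_mul (8 * N ^ 2), abs_mul (4 * N ^ 2), abs_of_nonneg (by positivity : (0 : ℝ) ≤ 8 * N ^ 2), abs_of_nonneg (by positivity : (0 : ℝ) ≤ 4 * N ^ 2)]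
          exact add_le_add (mul_le_mul_of_nonneg_left ((abs_add_le _ _).trans (add_le_add a1 a2)) (by positivity))
            (mul_le_mul_of_nonneg_left a3 (by positivity))
        _ = 20 * N ^ 2 * e0 := by ring
    -- the first-difference products
    set X := fwdDiffFun G (unitVec μ) w with hXd
    set X0 := fwdDiffFun g (unitVec μ) w with hX0d
    set Y := fwdDiffFun G (unitVec ν) (w + unitVec μ) + fwdDiffFun G (unitVec ν) w with hYd
    set Y0 := fwdDiffFun g (unitVec ν) (w + unitVec μ) + fwdDiffFun g (unitVec ν) w with hY0d
    set Z := fwdDiffFun G (unitVec ν) w with hZd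
    set Z0 := fwdDiffFun g (unitVec ν) w with hZ0d
    have hXX : |X - X0| ≤ e1 := by
      have h := h1 w μ; rw [hXd, hX0d]; simp only [fwdDiffFun]
      calc |G (w + unitVec μ) - G w - (g (w + unitVec μ) - g w)| = |(G (w + unitVec μ) - g (w + unitVec μ)) - (G w - g w)| := by ring_nf
        _ ≤ e1 := h
    have hX0 : |X0| ≤ C3 / t ^ 3 := by have h := hg3 w hw0 μ; rwa [hsup] at h
    have hYa : |fwdDiffFun G (unitVec ν) (w + unitVec μ)| ≤ W1 := abs_dG_shift_le_window hU0 hC3 hgU hg3 h1 hw hsμ ν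
    have hZ : |Z| ≤ W1 := by
      have h := abs_dG_shift_le_window hU0 hC3 hgU hg3 h1 hw hs0 ν
      simp only [add_zero] at h
      exact h
    have hY : |Y| ≤ W1 + W1 := (abs_add_le _ _).trans (add_le_add hYa hZ)
    have hYY : |Y - Y0| ≤ e1 + e1 := by
      have b1 := h1 (w + unitVec μ) ν
      have b2 := h1 w ν
      rw [hYd, hY0d]; simp only [fwdDiffFun]
      calc |G (w + unitVec μ + unitVec ν) - G (w + unitVec μ) + (G (w + unitVec ν) - G w) -
            (g (w + unitVec μ + unitVec ν) - g (w + unitVec μ) + (g (w + unitVec ν) - g w))|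
          = |((G (w + unitVec μ + unitVec ν) - g (w + unitVec μ + unitVec ν)) - (G (w + unitVec μ) - g (w + unitVec μ))) +
              ((G (w + unitVec ν) - g (w + unitVec ν)) - (G w - g w))| := by ring_nf
        _ ≤ _ := (abs_add_le _ _).trans (add_le_add b1 b2)
    have hZZ : |Z - Z0| ≤ e1 := by
      have b2 := h1 w ν
      rw [hZd, hZ0d]; simp only [fwdDiffFun]
      calc |G (w + unitVec ν) - G w - (g (w + unitVec ν) - g w)| = |(G (w + unitVec ν) - g (w + unitVec ν)) - (G w - g w)| := by ring_nf
        _ ≤ e1 := b2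
    have hP : |(8 * N ^ 2 * (X * Y) + 4 * N ^ 2 * (X * Z)) - (8 * N ^ 2 * (X0 * Y0) + 4 * N ^ 2 * (X0 * Z0))| ≤
        20 * N ^ 2 * (e1 * (W1 + C3 / t ^ 3)) := by
      have e : (8 * N ^ 2 * (X * Y) + 4 * N ^ 2 * (X * Z)) - (8 * N ^ 2 * (X0 * Y0) + 4 * N ^ 2 * (X0 * Z0)) =
          8 * N ^ 2 * ((X - X0) * Y + X0 * (Y - Y0)) + 4 * N ^ 2 * ((X - X0) * Z + X0 * (Z - Z0)) := by ring
      rw [e]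
      have f1 : |(X - X0) * Y + X0 * (Y - Y0)| ≤ e1 * (W1 + W1) + C3 / t ^ 3 * (e1 + e1) := by
        calc _ ≤ |(X - X0) * Y| + |X0 * (Y - Y0)| := abs_add_le _ _
          _ ≤ e1 * (W1 + W1) + C3 / t ^ 3 * (e1 + e1) := by
            rw [abs_mul, abs_mul]
            exact add_le_add (mul_le_mul hXX hY (abs_nonneg _) he10) (mul_le_mul hX0 hYY (abs_nonneg _) (by positivity))
      have f2 : |(X - X0) * Z + X0 * (Z - Z0)| ≤ e1 * W1 + C3 / t ^ 3 * e1 := by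
        calc _ ≤ |(X - X0) * Z| + |X0 * (Z - Z0)| := abs_add_le _ _
          _ ≤ e1 * W1 + C3 / t ^ 3 * e1 := by
            rw [abs_mul, abs_mul]
            exact add_le_add (mul_le_mul hXX hZ (abs_nonneg _) he10) (mul_le_mul hX0 hZZ (abs_nonneg _) (by positivity))
      calc _ ≤ |8 * N ^ 2 * ((X - X0) * Y + X0 * (Y - Y0))| + |4 * N ^ 2 * ((X - X0) * Z + X0 * (Z - Z0))| := abs_add_le _ _
        _ ≤ 8 * N ^ 2 * (e1 * (W1 + W1) + C3 / t ^ 3 * (e1 + e1)) + 4 * N ^ 2 * (e1 * W1 + C3 / t ^ 3 * e1) := by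
          rw [abs_mul (8 * N ^ 2), abs_mul (4 * N ^ 2), abs_of_nonneg (by positivity : (0 : ℝ) ≤ 8 * N ^ 2), abs_of_nonneg (by positivity : (0 : ℝ) ≤ 4 * N ^ 2)]
          exact add_le_add (mul_le_mul_of_nonneg_left f1 (by positivity)) (mul_le_mul_of_nonneg_left f2 (by positivity))
        _ = 20 * N ^ 2 * (e1 * (W1 + C3 / t ^ 3)) := by ring
    rw [rem_sub_free_eq N G g w, abs_mul]
    refine mul_le_mul hwt ((abs_add_le _ _).trans (add_le_add ?_ hP)) (abs_nonneg _) (by positivity)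
    rw [abs_mul]
    exact mul_le_mul hD hQ (abs_nonneg _) (by positivity)
  refine (ShellStencils.shell_sum_le_of_pointwise (by positivity) hpt).trans ?_
  have f1 := pow_div_pow_succ_le ht0 htn 1
  have f2 := pow_div_pow_succ_le ht0 htn 2
  have f5 := pow_div_pow_succ_le ht0 htn 5
  have key : 80 * t ^ 3 * (t ^ 2 * (C4 / t ^ 4 * (20 * N ^ 2 * e0) + 20 * N ^ 2 * (e1 * (W1 + C3 / t ^ 3)))) =
      1600 * N ^ 2 * (C4 * D0 * (t ^ 1 / (n : ℝ) ^ (1 + 1)) + D1 * (16 * U0 + 9 * C3) * (t ^ 2 / (n : ℝ) ^ (2 + 1)) +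
        D1 * D1 * (t ^ 5 / (n : ℝ) ^ (5 + 1))) := by
    rw [hW1, he0, he1]
    field_simp
    ring
  rw [key]
  have i1 : C4 * D0 * (t ^ 1 / (n : ℝ) ^ (1 + 1)) ≤ C4 * D0 * (1 / n) := mul_le_mul_of_nonneg_left f1 (by positivity)
  have i2 : D1 * (16 * U0 + 9 * C3) * (t ^ 2 / (n : ℝ) ^ (2 + 1)) ≤ D1 * (16 * U0 + 9 * C3) * (1 / n) :=
    mul_le_mul_of_nonneg_left f2 (by positivity)
  have i3 : D1 * D1 * (t ^ 5 / (n : ℝ) ^ (5 + 1)) ≤ D1 * D1 * (1 / n) := mul_le_mul_of_nonneg_left f5 (by positivity)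
  calc 1600 * N ^ 2 * (C4 * D0 * (t ^ 1 / (n : ℝ) ^ (1 + 1)) + D1 * (16 * U0 + 9 * C3) * (t ^ 2 / (n : ℝ) ^ (2 + 1)) +
        D1 * D1 * (t ^ 5 / (n : ℝ) ^ (5 + 1)))
      ≤ 1600 * N ^ 2 * (C4 * D0 * (1 / n) + D1 * (16 * U0 + 9 * C3) * (1 / n) + D1 * D1 * (1 / n)) := by
        apply mul_le_mul_of_nonneg_left _ (by positivity)
        linarith
    _ = 1600 * N ^ 2 * (C4 * D0 + D1 * (16 * U0 + 9 * C3) + D1 * D1) / n := by ring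

include hμν hn hU0 hC2 hC3 hC4 hD0 hD1 hA0 hA1 hδ hgU hg2 hg3 hg4 h0 h1 d0 d1 in
/-- [folklore] **THE A₁-FORM FROM FIRST-ORDER ROWS ONLY** (fixed blocking factor `n ≥ 2`): for a profile `G` with `h0`/`h1` (everywhere, against a reference `g`
with `|g| ≤ U₀`, `|g| ≤ C₂/‖·‖²`, `|F g| ≤ C₃/‖·‖³`, `|D_{μν}g| ≤ C₄/‖·‖⁴` off the origin) and `d0`/`d1` (off the origin, rate `δ/n`):
`|fullSum (stK μ ν N G) − Σ_{0<‖w‖∞≤n} stK μ ν N g w| ≤ K_S + K_W + 80·(E_S + E_B)·(1 + 1/δ)` — n-UNIFORM, and NO second-difference row of `G`. -/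
theorem sbp_A1 :
    |fullSum (stK μ ν N G) - ∑ w ∈ annulus 4 0 n, stK μ ν N g w| ≤
      1600 * N ^ 2 * D1 * (4 * (U0 + C2) + D0 + 8 * (2 * U0 + C3) + D1) +
        1600 * N ^ 2 * (C4 * D0 + D1 * (16 * U0 + 9 * C3) + D1 * D1) +
          80 * (20 * N ^ 2 * Real.exp δ * (4 * A0 + 8 * A1) * (8 * A1 + C3) + Real.exp δ * N ^ 2 * (80 * A0 * C4 + 1280 * A1 ^ 2)) *
            (1 + 1 / δ) := by
  obtain ⟨hn0, hn1, hc, hexp⟩ := n_facts hn hδ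
  have hn1' : 1 ≤ n := le_trans one_le_two hn
  -- the split
  have hsplit : stK μ ν N G = fun w => (fun v : Pt => toReal v μ * toReal v ν * (8 * N ^ 2 * (G (v + unitVec ν + unitVec μ) + G (v + unitVec ν)) - 4 * N ^ 2 * G v)) w * ((fun v : Pt => (G (v + unitVec μ) - g (v + unitVec μ)) - (G v - g v)) (w + unitVec ν) - (fun v : Pt => (G (v + unitVec μ) - g (v + unitVec μ)) - (G v - g v)) w) + (fun w : Pt => toReal w μ * toReal w ν * (mixedDiffFun g (unitVec μ) (unitVec ν) w * (8 * N ^ 2 * (G (w + unitVec ν + unitVec μ) + G (w + unitVec ν)) - 4 * N ^ 2 * G w) + (8 * N ^ 2 * (fwdDiffFun G (unitVec μ) w * (fwdDiffFun G (unitVec ν) (w + unitVec μ) + fwdDiffFun G (unitVec ν) w)) + 4 * N ^ 2 * (fwdDiffFun G (unitVec μ) w * fwdDiffFun G (unitVec ν) w)))) w := funext fun w => stK_eq_sbp_add_rem N G g w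
  -- the summation-by-parts term: summable, `fullSum = tsum`, bounded
  have hS1 : Summable fun w => (fun v : Pt => toReal v μ * toReal v ν * (8 * N ^ 2 * (G (v + unitVec ν + unitVec μ) + G (v + unitVec ν)) - 4 * N ^ 2 * G v)) w * (fun v : Pt => (G (v + unitVec μ) - g (v + unitVec μ)) - (G v - g v)) (w + unitVec ν) :=
    summable_phi_mul hμν N hn G g hU0 hD0 hA0 hδ hgU h0 d0 (fun v => (fun v : Pt => (G (v + unitVec μ) - g (v + unitVec μ)) - (G v - g v)) (v + unitVec ν)) (by positivity) (fun v => h1 (v + unitVec ν) μ)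
  have hS2 : Summable fun w => (fun v : Pt => toReal v μ * toReal v ν * (8 * N ^ 2 * (G (v + unitVec ν + unitVec μ) + G (v + unitVec ν)) - 4 * N ^ 2 * G v)) w * (fun v : Pt => (G (v + unitVec μ) - g (v + unitVec μ)) - (G v - g v)) w :=
    summable_phi_mul hμν N hn G g hU0 hD0 hA0 hδ hgU h0 d0 (fun v => (fun v : Pt => (G (v + unitVec μ) - g (v + unitVec μ)) - (G v - g v)) v) (by positivity) (fun v => h1 v μ)
  have hSA : Summable fun w => (fun v : Pt => toReal v μ * toReal v ν * (8 * N ^ 2 * (G (v + unitVec ν + unitVec μ) + G (v + unitVec ν)) - 4 * N ^ 2 * G v)) w * ((fun v : Pt => (G (v + unitVec μ) - g (v + unitVec μ)) - (G v - g v)) (w + unitVec ν) - (fun v : Pt => (G (v + unitVec μ) - g (v + unitVec μ)) - (G v - g v)) w) := by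
    have h := hS1.sub hS2
    refine h.congr fun w => ?_
    ring
  have hfsA : fullSum (fun w => (fun v : Pt => toReal v μ * toReal v ν * (8 * N ^ 2 * (G (v + unitVec ν + unitVec μ) + G (v + unitVec ν)) - 4 * N ^ 2 * G v)) w * ((fun v : Pt => (G (v + unitVec μ) - g (v + unitVec μ)) - (G v - g v)) (w + unitVec ν) - (fun v : Pt => (G (v + unitVec μ) - g (v + unitVec μ)) - (G v - g v)) w)) = ∑' w, (fun v : Pt => toReal v μ * toReal v ν * (8 * N ^ 2 * (G (v + unitVec ν + unitVec μ) + G (v + unitVec ν)) - 4 * N ^ 2 * G v)) w * ((fun v : Pt => (G (v + unitVec μ) - g (v + unitVec μ)) - (G v - g v)) (w + unitVec ν) - (fun v : Pt => (G (v + unitVec μ) - g (v + unitVec μ)) - (G v - g v)) w) := by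
    rw [WindowIdentification.fullSum_eq_tsum_sub _ hSA, sub_eq_self]
    simp [DyadicShell.toReal]
  have hA := abs_tsum_sbp_le hμν N hn G g hU0 hC2 hC3 hD0 hD1 hA0 hA1 hδ hgU hg2 hg3 h0 h1 d0 d1
  -- the remainder: full sum exists, tail beyond the window, window comparison
  set EB := Real.exp δ * N ^ 2 * (80 * A0 * C4 + 1280 * A1 ^ 2) with hEB
  have hEB0 : 0 ≤ EB := by rw [hEB]; positivity
  have htailB : ∀ r : ℕ, 1 ≤ r → ∀ w ∈ annulus 4 r (r + 1), |(fun w : Pt => toReal w μ * toReal w ν * (mixedDiffFun g (unitVec μ) (unitVec ν) w * (8 * N ^ 2 * (G (w + unitVec ν + unitVec μ) + G (w + unitVec ν)) - 4 * N ^ 2 * G w) + (8 * N ^ 2 * (fwdDiffFun G (unitVec μ) w * (fwdDiffFun G (unitVec ν) (w + unitVec μ) + fwdDiffFun G (unitVec ν) w)) + 4 * N ^ 2 * (fwdDiffFun G (unitVec μ) w * fwdDiffFun G (unitVec ν) w)))) w| ≤ EB / ((r : ℝ) + 1) ^ 4 * Real.exp (-(δ / n) * ((r : ℝ) + 1)) 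:=
    fun r hr w hw => abs_rem_le_tail hμν N hn G g hC4 hA0 hA1 hδ hg4 d0 d1 hr hw
  have hBex := WindowIdentification.exists_tendsto_psum_of_shellBound hEB0 hδ hn0 htailB
  have hBtail := WindowIdentification.abs_fullSum_sub_psum_le hEB0 hδ hn0 htailB (R := n) hn1'
  have hBwin : |∑ w ∈ annulus 4 0 n, (fun w : Pt => toReal w μ * toReal w ν * (mixedDiffFun g (unitVec μ) (unitVec ν) w * (8 * N ^ 2 * (G (w + unitVec ν + unitVec μ) + G (w + unitVec ν)) - 4 * N ^ 2 * G w) + (8 * N ^ 2 * (fwdDiffFun G (unitVec μ) w * (fwdDiffFun G (unitVec ν) (w + unitVec μ) + fwdDiffFun G (unitVec ν) w)) + 4 * N ^ 2 * (fwdDiffFun G (unitVec μ) w * fwdDiffFun G (unitVec ν) w)))) w - ∑ w ∈ annulus 4 0 n, stK μ ν N g w| ≤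
      1600 * N ^ 2 * (C4 * D0 + D1 * (16 * U0 + 9 * C3) + D1 * D1) :=
    ShellWindowInterface.window_sub_le_of_shellRows (by positivity) hn1' le_rfl
      fun r hr => window_rem_sub_free_le hμν N hn G g hU0 hC3 hC4 hD0 hD1 hgU hg3 hg4 h0 h1 hr
  -- full sum of the split
  have hfs : fullSum (stK μ ν N G) = fullSum (fun w => (fun v : Pt => toReal v μ * toReal v ν * (8 * N ^ 2 * (G (v + unitVec ν + unitVec μ) + G (v + unitVec ν)) - 4 * N ^ 2 * G v)) w * ((fun v : Pt => (G (v + unitVec μ) - g (v + unitVec μ)) - (G v - g v)) (w + unitVec ν) - (fun v : Pt => (G (v + unitVec μ) - g (v + unitVec μ)) - (G v - g v)) w)) + fullSum (fun w : Pt => toReal w μ * toReal w ν * (mixedDiffFun g (unitVec μ) (unitVec ν) w * (8 * N ^ 2 * (G (w + unitVec ν + unitVec μ) + G (w + unitVec ν)) - 4 * N ^ 2 * G w) + (8 * N ^ 2 * (fwdDiffFun G (unitVec μ) w * (fwdDiffFun G (unitVec ν) (w + unitVec μ) + fwdDiffFun G (unitVec ν) w)) + 4 * N ^ 2 * (fwdDiffFun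 G (unitVec μ) w * fwdDiffFun G (unitVec ν) w)))) := by
    rw [hsplit]
    exact WindowIdentification.fullSum_add (WindowIdentification.exists_tendsto_psum_of_summable _ hSA) hBex
  -- the tail constants are n-uniform
  have hratio : (1 + (n : ℝ) / δ) / ((n : ℝ) + 1) ≤ 1 + 1 / δ := by
    rw [div_le_iff₀ (by positivity : (0 : ℝ) < (n : ℝ) + 1)]
    have key : (1 + 1 / δ) * ((n : ℝ) + 1) - (1 + (n : ℝ) / δ) = n + 1 / δ := by ring
    have h2 : (0 : ℝ) ≤ 1 / δ := by positivity
    linarith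
  set ES := 20 * N ^ 2 * Real.exp δ * (4 * A0 + 8 * A1) * (8 * A1 + C3) with hES
  have hES0 : 0 ≤ ES := by rw [hES]; positivity
  have hTS : 80 * ES * (1 + n / δ) / ((n : ℝ) + 1) ≤ 80 * ES * (1 + 1 / δ) := by
    have := mul_le_mul_of_nonneg_left hratio (by positivity : (0 : ℝ) ≤ 80 * ES)
    calc 80 * ES * (1 + n / δ) / ((n : ℝ) + 1) = 80 * ES * ((1 + n / δ) / ((n : ℝ) + 1)) := by ring
      _ ≤ 80 * ES * (1 + 1 / δ) := this
  have hTB : 80 * EB * (1 + n / δ) / ((n : ℝ) + 1) ≤ 80 * EB * (1 + 1 / δ) := by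
    have := mul_le_mul_of_nonneg_left hratio (by positivity : (0 : ℝ) ≤ 80 * EB)
    calc 80 * EB * (1 + n / δ) / ((n : ℝ) + 1) = 80 * EB * ((1 + n / δ) / ((n : ℝ) + 1)) := by ring
      _ ≤ 80 * EB * (1 + 1 / δ) := this
  -- assemble
  rw [hfs, hfsA]
  have e : ∑' w, (fun v : Pt => toReal v μ * toReal v ν * (8 * N ^ 2 * (G (v + unitVec ν + unitVec μ) + G (v + unitVec ν)) - 4 * N ^ 2 * G v)) w * ((fun v : Pt => (G (v + unitVec μ) - g (v + unitVec μ)) - (G v - g v)) (w + unitVec ν) - (fun v : Pt => (G (v + unitVec μ) - g (v + unitVec μ)) - (G v - g v)) w) + fullSum (fun w : Pt => toReal w μ * toReal w ν * (mixedDiffFun g (unitVec μ) (unitVec ν) w * (8 * N ^ 2 * (G (w + unitVec ν + unitVec μ) + G (w + unitVec ν)) - 4 * N ^ 2 * G w) + (8 * N ^ 2 * (fwdDiffFun G (unitVec μ) w * (fwdDiffFun G (unitVec ν) (w + unitVec μ) + fwdDiffFun G (unitVec ν) w)) + 4 * N ^ 2 * (fwdDiffFun G (unitVec μ) w * fwdDiffFun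 G (unitVec ν) w)))) - ∑ w ∈ annulus 4 0 n, stK μ ν N g w =
      ∑' w, (fun v : Pt => toReal v μ * toReal v ν * (8 * N ^ 2 * (G (v + unitVec ν + unitVec μ) + G (v + unitVec ν)) - 4 * N ^ 2 * G v)) w * ((fun v : Pt => (G (v + unitVec μ) - g (v + unitVec μ)) - (G v - g v)) (w + unitVec ν) - (fun v : Pt => (G (v + unitVec μ) - g (v + unitVec μ)) - (G v - g v)) w) + (fullSum (fun w : Pt => toReal w μ * toReal w ν * (mixedDiffFun g (unitVec μ) (unitVec ν) w * (8 * N ^ 2 * (G (w + unitVec ν + unitVec μ) + G (w + unitVec ν)) - 4 * N ^ 2 * G w) + (8 * N ^ 2 * (fwdDiffFun G (unitVec μ) w * (fwdDiffFun G (unitVec ν) (w + unitVec μ) + fwdDiffFun G (unitVec ν) w)) + 4 * N ^ 2 * (fwdDiffFun G (unitVec μ) w * fwdDiffFun G (unitVec ν) w)))) - psum (fun w : Pt => toReal w μ * toReal w ν * (mixedDiffFun g (unitVec μ) (unitVec ν) w * (8 * N ^ 2 * (G (w + unitVec ν + unitVec μ) + G (w + unitVec ν)) - 4 * N ^ 2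 * G w) + (8 * N ^ 2 * (fwdDiffFun G (unitVec μ) w * (fwdDiffFun G (unitVec ν) (w + unitVec μ) + fwdDiffFun G (unitVec ν) w)) + 4 * N ^ 2 * (fwdDiffFun G (unitVec μ) w * fwdDiffFun G (unitVec ν) w)))) n) +
        (∑ w ∈ annulus 4 0 n, (fun w : Pt => toReal w μ * toReal w ν * (mixedDiffFun g (unitVec μ) (unitVec ν) w * (8 * N ^ 2 * (G (w + unitVec ν + unitVec μ) + G (w + unitVec ν)) - 4 * N ^ 2 * G w) + (8 * N ^ 2 * (fwdDiffFun G (unitVec μ) w * (fwdDiffFun G (unitVec ν) (w + unitVec μ) + fwdDiffFun G (unitVec ν) w)) + 4 * N ^ 2 * (fwdDiffFun G (unitVec μ) w * fwdDiffFun G (unitVec ν) w)))) w - ∑ w ∈ annulus 4 0 n, stK μ ν N g w) := by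
    rw [WindowIdentification.psum_def]; ring
  rw [e]
  calc |∑' w, (fun v : Pt => toReal v μ * toReal v ν * (8 * N ^ 2 * (G (v + unitVec ν + unitVec μ) + G (v + unitVec ν)) - 4 * N ^ 2 * G v)) w * ((fun v : Pt => (G (v + unitVec μ) - g (v + unitVec μ)) - (G v - g v)) (w + unitVec ν) - (fun v : Pt => (G (v + unitVec μ) - g (v + unitVec μ)) - (G v - g v)) w) + (fullSum (fun w : Pt => toReal w μ * toReal w ν * (mixedDiffFun g (unitVec μ) (unitVec ν) w * (8 * N ^ 2 * (G (w + unitVec ν + unitVec μ) + G (w + unitVec ν)) - 4 * N ^ 2 * G w) + (8 * N ^ 2 * (fwdDiffFun G (unitVec μ) w * (fwdDiffFun G (unitVec ν) (w + unitVec μ) + fwdDiffFun G (unitVec ν) w)) + 4 * N ^ 2 * (fwdDiffFun G (unitVec μ) w * fwdDiffFun G (unitVec ν) w)))) - psum (fun w : Pt => toReal w μ * toReal w ν * (mixedDiffFun g (unitVec μ) (unitVec ν) w * (8 * N ^ 2 * (G (w + unitVec ν + unitVec μ) + G (w + unitVec ν)) - 4 * N ^ 2 * G w) + (8 * N ^ 2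 * (fwdDiffFun G (unitVec μ) w * (fwdDiffFun G (unitVec ν) (w + unitVec μ) + fwdDiffFun G (unitVec ν) w)) + 4 * N ^ 2 * (fwdDiffFun G (unitVec μ) w * fwdDiffFun G (unitVec ν) w)))) n) +
        (∑ w ∈ annulus 4 0 n, (fun w : Pt => toReal w μ * toReal w ν * (mixedDiffFun g (unitVec μ) (unitVec ν) w * (8 * N ^ 2 * (G (w + unitVec ν + unitVec μ) + G (w + unitVec ν)) - 4 * N ^ 2 * G w) + (8 * N ^ 2 * (fwdDiffFun G (unitVec μ) w * (fwdDiffFun G (unitVec ν) (w + unitVec μ) + fwdDiffFun G (unitVec ν) w)) + 4 * N ^ 2 * (fwdDiffFun G (unitVec μ) w * fwdDiffFun G (unitVec ν) w)))) w - ∑ w ∈ annulus 4 0 n, stK μ ν N g w)|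
      ≤ |∑' w, (fun v : Pt => toReal v μ * toReal v ν * (8 * N ^ 2 * (G (v + unitVec ν + unitVec μ) + G (v + unitVec ν)) - 4 * N ^ 2 * G v)) w * ((fun v : Pt => (G (v + unitVec μ) - g (v + unitVec μ)) - (G v - g v)) (w + unitVec ν) - (fun v : Pt => (G (v + unitVec μ) - g (v + unitVec μ)) - (G v - g v)) w)| + |fullSum (fun w : Pt => toReal w μ * toReal w ν * (mixedDiffFun g (unitVec μ) (unitVec ν) w * (8 * N ^ 2 * (G (w + unitVec ν + unitVec μ) + G (w + unitVec ν)) - 4 * N ^ 2 * G w) + (8 * N ^ 2 * (fwdDiffFun G (unitVec μ) w * (fwdDiffFun G (unitVec ν) (w + unitVec μ) + fwdDiffFun G (unitVec ν) w)) + 4 * N ^ 2 * (fwdDiffFun G (unitVec μ) w * fwdDiffFun G (unitVec ν) w)))) - psum (fun w : Pt => toReal w μ * toReal w ν * (mixedDiffFun g (unitVec μ) (unitVec ν) w * (8 * N ^ 2 * (G (w + unitVec ν + unitVec μ) + G (w + unitVec ν)) - 4 * N ^ 2 * G w) + (8 * N ^ 2 * (fwdDiffFun G (unitVec μ) w * (fwdDiffFun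 G (unitVec ν) (w + unitVec μ) + fwdDiffFun G (unitVec ν) w)) + 4 * N ^ 2 * (fwdDiffFun G (unitVec μ) w * fwdDiffFun G (unitVec ν) w)))) n| +
        |∑ w ∈ annulus 4 0 n, (fun w : Pt => toReal w μ * toReal w ν * (mixedDiffFun g (unitVec μ) (unitVec ν) w * (8 * N ^ 2 * (G (w + unitVec ν + unitVec μ) + G (w + unitVec ν)) - 4 * N ^ 2 * G w) + (8 * N ^ 2 * (fwdDiffFun G (unitVec μ) w * (fwdDiffFun G (unitVec ν) (w + unitVec μ) + fwdDiffFun G (unitVec ν) w)) + 4 * N ^ 2 * (fwdDiffFun G (unitVec μ) w * fwdDiffFun G (unitVec ν) w)))) w - ∑ w ∈ annulus 4 0 n, stK μ ν N g w| :=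
          (abs_add_le _ _).trans (add_le_add (abs_add_le _ _) le_rfl)
    _ ≤ (1600 * N ^ 2 * D1 * (4 * (U0 + C2) + D0 + 8 * (2 * U0 + C3) + D1) + 80 * ES * (1 + n / δ) / ((n : ℝ) + 1)) +
        80 * EB * (1 + n / δ) / ((n : ℝ) + 1) + 1600 * N ^ 2 * (C4 * D0 + D1 * (16 * U0 + 9 * C3) + D1 * D1) :=
          add_le_add (add_le_add hA hBtail) hBwin
    _ ≤ (1600 * N ^ 2 * D1 * (4 * (U0 + C2) + D0 + 8 * (2 * U0 + C3) + D1) + 80 * ES * (1 + 1 / δ)) +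
        80 * EB * (1 + 1 / δ) + 1600 * N ^ 2 * (C4 * D0 + D1 * (16 * U0 + 9 * C3) + D1 * D1) := by
          gcongr
    _ = _ := by rw [hES, hEB]; ring

end Main

end Summit.QuantumFields.BalabanUV.Beta.D1BFx.SbpShellRemainder

end
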